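import Mathlib
import Literature.NumberTheory.Transcendental.ZilberFieldAutomorphisms
import Literature.NumberTheory.Transcendental.ZilberFieldQuasiminimal
import Summits.Schanuel.Schanuel.Theorems.RigidCoreAclSubsetLogFreeCoreLogShift

/-!
# Crux `RigidCore.AclSubsetLogFreeCore` (stmt-Schanuel-0968), line `eac-extends-core-automorphisms`:
hull-to-core — Γ-isomorphic strong tuples of `ℂ_exp` are conjugate under an automorphism of the countable core

Under Zilber's conjecture (`IsZilberField ℂ`), a Γ-isomorphism `c ↦ c'` over the identity of the
base Γ-field `ℚ^{ab}(2πi)` between finite tuples spanning (with the kernel) STRONG subspaces of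
`ℂ_exp` is realised by an exponential-field automorphism `g` of the countable core `C₀ = ecl ∅`:
`IsEIsoOn g (ecl ∅) (ecl ∅)` with `g (c j) = c' j`.  This is the tree's hull-to-closure theorem
`ZilberAutomorphisms.exists_isEIsoOn_of_isGammaIsoTw₂` (Kirby 2010 Thm 2.1; Kirby–Macintyre–Onshuus
2012 §3.5; Bays–Kirby 2018 Lemma 8.3), which gives an isomorphism `ecl (range c) ≅ ecl (range c')`
mapping `c ↦ c'`, restricted to the prime closure `ecl ∅ ⊆ ecl (range c)` (`IsEIsoOn.restrict`).
It is the device by which the reshaped line turns PARTNERS (Γ-isomorphic copies of a hull) into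
core automorphisms moving a prescribed element; helper for the residue stub
`stub_coreFixedField_logFree` of the line (item stmt-Schanuel-0968).
-/

noncomputable section

set_option linter.dupNamespace false

open Set
open Literature.ModelTheory.ExponentialFields Literature.ModelTheory.ExponentialFields.ExponentialRing
open Literature.NumberTheory.Transcendental Literature.NumberTheory.Transcendental.GammaField

namespace Summit.Schanuel.Schanuel.Theorems.RigidCore

/-- **Hull-to-core (under Zilber's conjecture).** If `ℂ_exp` is a Zilber field, a Γ-isomorphism
`c ↦ c'` over the identity of `ℚ^{ab}(τ)` (`τ = 2πi`) between tuples with `ℚτ + ℚc ◁ ℂ` and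
`ℚτ + ℚc' ◁ ℂ` is induced by an exponential-field automorphism of the countable core `ecl ∅`
mapping `c j ↦ c' j` (as a map `g : ℂ → ℂ` with `IsEIsoOn g (ecl ∅) (ecl ∅)`; the values
`g (c j) = c' j` hold for all `j`, and are values of the core automorphism whenever `c j ∈ ecl ∅`).
Stated over a variable `τ` with `hτ : τ = 2πi` (the literal inside types is expensive to unify). -/
theorem hullToCore (hZ : IsZilberField ℂ) (τ : ℂ) (hτ : τ = 2 * ↑Real.pi * Complex.I) {N : ℕ}
    {c c' : Fin N → ℂ}
    (hiso : IsGammaIsoTw₂ (RingEquiv.refl (fieldOf (Submodule.span ℚ ({τ} : Set ℂ)))) c c')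
    (hs : IsStrong (Submodule.span ℚ ({τ} : Set ℂ) ⊔ Submodule.span ℚ (range c)))
    (hs' : IsStrong (Submodule.span ℚ ({τ} : Set ℂ) ⊔ Submodule.span ℚ (range c'))) :
    ∃ g : ℂ → ℂ, IsEIsoOn g (ecl (∅ : Set ℂ)) (ecl (∅ : Set ℂ)) ∧ ∀ j, g (c j) = c' j := by
  subst hτ
  obtain ⟨g, hg, hgc, -⟩ := ZilberAutomorphisms.exists_isEIsoOn_of_isGammaIsoTw₂ hZ
    logShift_expKernel_complex logShift_expKernel_complex Complex.two_pi_I_ne_zero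
    Complex.two_pi_I_ne_zero (IsEBaseIso₂.refl _) hiso hs hs'
  have h0 := hg.restrict (Set.empty_subset _)
  rw [Set.image_empty] at h0
  exact ⟨g, h0, hgc⟩

end Summit.Schanuel.Schanuel.Theorems.RigidCore
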